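import Summits.Parity.GeneralizedHardyLittlewood.Theorems.LeeYangFibresRelativeDimOneDefs
import Summits.Parity.GeneralizedHardyLittlewood.Theorems.LeeYangFibresRelativeDimOne
import Summits.Parity.GeneralizedHardyLittlewood.Theorems.LeeYangFibresCellParityLawSingularRatio
import Literature.NumberTheory.Sieve.LinearEquationsInPrimesCrudeBounds
import HarnessLib

/-!
# Route `LeeYangFibres`, crux `RelativeDimOne` (stmt-Parity-14113), line `SketchIdeator1` =
`translate-amplification`: tightness of the atom and the small facts every stub uses

Sorry-free facts of the line over the vocabulary `LeeYangFibresRelativeDimOneDefs.lean`: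

* `K_H ⊆ K` and its convexity (`meetTranslates_subset`, `convex_meetTranslates`), the size bound
  `‖Ψ^{(H)}‖_N ≤ (3m+1)L` on the shift box (`affLinSize_translateFamily_le`) and the trivial bound
  `S(Φ,K,N) ≤ (2N+1) log^T(2LN)` (`vonMangoldtSum_le_card_mul`) — the hypotheses under which the atom
  and `SingularTail` are applied to translate-constellations in `stub_amplification` / `stub_singularMeanGlue`;
* **`coarseHLSlack_of_relativeDimOne : RelativeDimOne → CoarseHLSlack`** (registered sub-goal) — the
  crux implies the line's atom (with `g ≡ 1`), so the atom is EQUIVALENT to the crux given the transfer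
  `Amplification` (the card's `CoarseOfRelative`).
-/

noncomputable section

open scoped BigOperators Classical Topology
open Finset Filter MeasureTheory Literature.NumberTheory.Sieve
open Summit.Parity.GeneralizedHardyLittlewood.Theses.LeeYangFibres (RelativeDimOne)

namespace Summit.Parity.GeneralizedHardyLittlewood.Cruxes.RelativeDimOne.TranslateAmplification

variable {t m : ℕ}

/-! ### Small facts about translate-constellations (used by the transfer and the glue) -/

/-- `K_H ⊆ K` (the condition at `j = 0`). -/
theorem meetTranslates_subset (K : Set (Fin 1 → ℝ)) (H : Fin m → ℤ) : meetTranslates K H ⊆ K := by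
  intro x hx
  have h0 := hx 0
  simpa using h0

/-- `K_H` is convex when `K` is (an intersection of translates of `K`). -/
theorem convex_meetTranslates {K : Set (Fin 1 → ℝ)} (hK : Convex ℝ K) (H : Fin m → ℤ) :
    Convex ℝ (meetTranslates K H) := by
  have : meetTranslates K H = ⋂ j : Fin (m + 1), (fun x : Fin 1 → ℝ => x + fun _ => (shiftVec H j : ℝ)) ⁻¹' K := by
    ext x
    simp only [meetTranslates, Set.mem_setOf_eq, Set.mem_iInter, Set.mem_preimage]
    exact Iff.rfl
  rw [this]
  exact convex_iInter fun j => hK.translate_preimage_left _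

/-- The size of a translate-constellation on the shift box: `‖Ψ^{(H)}‖_N ≤ (3m+1) ‖Ψ‖_N`-type bound,
`‖Ψ^{(H)}‖_N ≤ (3m+1) L` when `‖Ψ‖_N ≤ L`, `|H_j| ≤ 2N`, `N ≥ 1`
(`|b_i + a_i H'_j| / N ≤ |b_i|/N + 2 |a_i|`). -/
theorem affLinSize_translateFamily_le {Ψ : Fin t → AffLinForm 1} {N : ℕ} {L : ℝ} (hN : 1 ≤ N)
    (hL : affLinSize Ψ N ≤ L) {H : Fin m → ℤ} (hH : H ∈ shiftBox m N) :
    affLinSize (translateFamily Ψ H) N ≤ (3 * m + 1) * L := by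
  have hN0 : (0 : ℝ) < N := by exact_mod_cast hN
  -- the two parts of `‖Ψ‖_N`
  set A := ∑ i, ∑ l, |((Ψ i).coeff l : ℝ)| with hA
  set Bc := ∑ i, |((Ψ i).const : ℝ) / N| with hBc
  have hAB : A + Bc = affLinSize Ψ N := rfl
  have hA0 : 0 ≤ A := Finset.sum_nonneg fun _ _ => Finset.sum_nonneg fun _ _ => abs_nonneg _
  have hB0 : 0 ≤ Bc := Finset.sum_nonneg fun _ _ => abs_nonneg _
  have hL0 : A + Bc ≤ L := hAB ▸ hL
  -- `|H'_j| ≤ 2N`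
  have hHj : ∀ j : Fin (m + 1), |(shiftVec H j : ℝ)| ≤ 2 * N := by
    intro j
    refine Fin.cases ?_ (fun j' => ?_) j
    · simp
    · rw [shiftVec_succ]
      have := Finset.mem_Icc.mp (Fintype.mem_piFinset.mp hH j')
      rw [← Int.cast_abs]
      have h' : |H j'| ≤ 2 * N := abs_le.mpr ⟨by omega, by omega⟩
      exact_mod_cast h'
  -- coefficient part: `(m+1) A`
  have hcoeff : ∑ k, ∑ l, |((translateFamily Ψ H k).coeff l : ℝ)| = (m + 1) * A := by
    rw [← Fintype.sum_equiv finProdFinEquiv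
        (fun ji : Fin (m + 1) × Fin t => ∑ l, |((translateFamily Ψ H (finProdFinEquiv ji)).coeff l : ℝ)|)
        (fun k => ∑ l, |((translateFamily Ψ H k).coeff l : ℝ)|) (fun _ => rfl)]
    rw [Fintype.sum_prod_type]
    simp only [translateFamily_apply, translateForm]
    rw [Finset.sum_const, Finset.card_univ, Fintype.card_fin, nsmul_eq_mul]
    push_cast
    ring
  -- constant part: `≤ (m+1) Bc + 2 m A`… bounded by `(m+1) Bc + 2 (m+1) A`; we use the cruder
  -- `∑_{(j,i)} (|b_i|/N + 2|a_i 0|) ≤ (m+1) (Bc + 2A)` and then sharpen with `j = 0` free of shift.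
  have hconst : ∑ k, |((translateFamily Ψ H k).const : ℝ) / N| ≤ (m + 1) * Bc + 2 * m * A := by
    rw [← Fintype.sum_equiv finProdFinEquiv
        (fun ji : Fin (m + 1) × Fin t => |((translateFamily Ψ H (finProdFinEquiv ji)).const : ℝ) / N|)
        (fun k => |((translateFamily Ψ H k).const : ℝ) / N|) (fun _ => rfl)]
    rw [Fintype.sum_prod_type]
    simp only [translateFamily_apply, translateForm]
    rw [Fin.sum_univ_succ]
    simp only [shiftVec_zero, mul_zero, add_zero, shiftVec_succ]
    have h1 : ∀ j : Fin m, ∑ i, |(((Ψ i).const + (Ψ i).coeff 0 * H j : ℤ) : ℝ) / N| ≤ Bc + 2 * A := by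
      intro j
      have hj : |(H j : ℝ)| ≤ 2 * N := by simpa using hHj j.succ
      calc ∑ i, |(((Ψ i).const + (Ψ i).coeff 0 * H j : ℤ) : ℝ) / N|
          ≤ ∑ i, (|((Ψ i).const : ℝ) / N| + 2 * |((Ψ i).coeff 0 : ℝ)|) := by
            refine Finset.sum_le_sum fun i _ => ?_
            push_cast
            rw [add_div, abs_le]
            constructor
            · have := neg_abs_le (((Ψ i).const : ℝ) / N)
              have h2 : -(2 * |((Ψ i).coeff 0 : ℝ)|) ≤ ((Ψ i).coeff 0 : ℝ) * (H j : ℝ) / N := by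
                rw [le_div_iff₀ hN0, mul_comm]
                have := neg_abs_le (((Ψ i).coeff 0 : ℝ) * (H j : ℝ))
                rw [abs_mul] at this
                nlinarith [abs_nonneg ((Ψ i).coeff 0 : ℝ), abs_nonneg (H j : ℝ)]
              linarith
            · have := le_abs_self (((Ψ i).const : ℝ) / N)
              have h2 : ((Ψ i).coeff 0 : ℝ) * (H j : ℝ) / N ≤ 2 * |((Ψ i).coeff 0 : ℝ)| := by
                rw [div_le_iff₀ hN0]
                have := le_abs_self (((Ψ i).coeff 0 : ℝ) * (H j : ℝ))
                rw [abs_mul] at this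
                nlinarith [abs_nonneg ((Ψ i).coeff 0 : ℝ), abs_nonneg (H j : ℝ)]
              linarith
        _ = Bc + 2 * ∑ i, |((Ψ i).coeff 0 : ℝ)| := by
            rw [Finset.sum_add_distrib, Finset.mul_sum]
        _ ≤ Bc + 2 * A := by
            have : ∑ i, |((Ψ i).coeff 0 : ℝ)| ≤ A :=
              Finset.sum_le_sum fun i _ => Finset.single_le_sum (f := fun l => |((Ψ i).coeff l : ℝ)|)
                (fun _ _ => abs_nonneg _) (Finset.mem_univ 0)
            linarith
    have h2 : ∑ j : Fin m, ∑ i, |(((Ψ i).const + (Ψ i).coeff 0 * H j : ℤ) : ℝ) / N| ≤ m * (Bc + 2 * A) := by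
      calc ∑ j : Fin m, ∑ i, |(((Ψ i).const + (Ψ i).coeff 0 * H j : ℤ) : ℝ) / N|
          ≤ ∑ _j : Fin m, (Bc + 2 * A) := Finset.sum_le_sum fun j _ => h1 j
        _ = m * (Bc + 2 * A) := by rw [Finset.sum_const, Finset.card_univ, Fintype.card_fin, nsmul_eq_mul]
    have h3 : ∑ i, |(((Ψ i).const : ℤ) : ℝ) / N| = Bc := rfl
    linarith [h3]
  calc affLinSize (translateFamily Ψ H) N
      = ∑ k, ∑ l, |((translateFamily Ψ H k).coeff l : ℝ)| + ∑ k, |((translateFamily Ψ H k).const : ℝ) / N| := rfl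
    _ ≤ (m + 1) * A + ((m + 1) * Bc + 2 * m * A) := by rw [hcoeff]; linarith
    _ ≤ (3 * m + 1) * L := by nlinarith

/-- The trivial bound: `S(Φ, K, N) ≤ (2N+1) log^T(2LN)` for `‖Φ‖_N ≤ L`, `L, N ≥ 1` (each of the `2N+1`
lattice points of the box carries weight `≤ log^T(2LN)`, `prod_intVonMangoldt_le`). -/
theorem vonMangoldtSum_le_card_mul {T : ℕ} {Φ : Fin T → AffLinForm 1} {N : ℕ} {L : ℝ} (hN : 1 ≤ N)
    (hL1 : 1 ≤ L) (hL : affLinSize Φ N ≤ L) (K : Set (Fin 1 → ℝ)) :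
    vonMangoldtSum Φ K N ≤ (2 * N + 1) * Real.log (2 * L * N) ^ T := by
  classical
  unfold vonMangoldtSum
  calc ∑ n ∈ (latticeBox 1 N).filter (fun n => realPoint n ∈ K), ∏ i, intVonMangoldt ((Φ i).eval n)
      ≤ ∑ n ∈ latticeBox 1 N, ∏ i, intVonMangoldt ((Φ i).eval n) :=
        Finset.sum_le_sum_of_subset_of_nonneg (Finset.filter_subset _ _)
          fun n hn _ => (prod_intVonMangoldt_le hN hL1 hL hn).1
    _ ≤ ∑ _n ∈ latticeBox 1 N, Real.log (2 * L * N) ^ T :=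
        Finset.sum_le_sum fun n hn => (prod_intVonMangoldt_le hN hL1 hL hn).2
    _ = (2 * N + 1) * Real.log (2 * L * N) ^ T := by
        rw [Finset.sum_const, nsmul_eq_mul]
        congr 1
        rw [latticeBox, Fintype.card_piFinset, Fin.prod_const, Int.card_Icc, pow_one]
        have : ((N : ℤ) + 1 - -(N : ℤ)).toNat = 2 * N + 1 := by omega
        rw [this]
        push_cast
        ring

/-! ### Tightness: the atom is implied by the crux (the card's `CoarseOfRelative`) -/

/-- The archimedean factor is non-negative (it is a `toReal`). -/
theorem archFactor_nonneg' {T : ℕ} (Φ : Fin T → AffLinForm 1) (K : Set (Fin 1 → ℝ)) :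
    0 ≤ archFactor Φ K := by
  unfold archFactor
  exact ENNReal.toReal_nonneg

/-- **The crux implies the atom** (tightness; `g ≡ 1`): from `|S − M| ≤ ε(M + N)` with
`ε = min η (1/2)` and `S, M ≥ 0`: `S ≤ (1+ε)M + εN ≤ e M + ηN` and `S ≥ (1−ε)M − εN ≥ e^{-1} M − ηN`.
So `CoarseHLSlack` is EQUIVALENT to `RelativeDimOne` (with `stub_amplification`). -/
theorem coarseHLSlack_of_relativeDimOne : RelativeDimOne → CoarseHLSlack := by
  intro h
  refine ⟨fun _ => 1, ?_, ?_⟩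
  · have h1 : Tendsto (fun T : ℕ => (1 : ℝ) / (T : ℝ)) atTop (𝓝 0) := tendsto_one_div_atTop_nhds_zero_nat
    exact h1
  · intro T L hT η hη
    obtain ⟨N₀, hN₀⟩ := h T L hT (min η (1 / 2)) (by positivity)
    refine ⟨N₀, fun N hN Φ hΦ hL K hK hKN => ?_⟩
    have hb := hN₀ N hN Φ hΦ hL K hK hKN
    have hS := Theorems.LeeYangFibresRelativeDimOne.vonMangoldtSum_nonneg Φ K N
    have hM : 0 ≤ archFactor Φ K * singularProduct Φ :=
      mul_nonneg (archFactor_nonneg' Φ K)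
        (CellParityLaw.SectionAnnihilator.SingularRatio.singularProduct_nonneg hΦ)
    set S := vonMangoldtSum Φ K N with hSdef
    set M := archFactor Φ K * singularProduct Φ with hMdef
    have hε1 : min η (1 / 2) ≤ η := min_le_left _ _
    have hε2 : min η (1 / 2) ≤ 1 / 2 := min_le_right _ _
    have hε0 : 0 < min η (1 / 2) := by positivity
    have hN0 : (0 : ℝ) ≤ N := Nat.cast_nonneg N
    have hab := abs_le.mp hb
    have he : (2 : ℝ) ≤ Real.exp 1 := by
      have := Real.add_one_le_exp (1 : ℝ)
      linarith
    have he' : Real.exp (-(1 : ℝ)) ≤ 1 / 2 := by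
      rw [Real.exp_neg]
      rw [inv_le_comm₀ (Real.exp_pos 1) (by norm_num)]
      linarith
    have hεM : min η (1 / 2) * M ≤ 1 / 2 * M := mul_le_mul_of_nonneg_right hε2 hM
    have hεN : min η (1 / 2) * (N : ℝ) ≤ η * N := mul_le_mul_of_nonneg_right hε1 hN0
    constructor
    · -- upper
      have h1 : S ≤ M + min η (1 / 2) * (M + N) := by linarith [hab.2]
      have h2 : M + 1 / 2 * M ≤ Real.exp 1 * M := by nlinarith
      show S ≤ Real.exp ((fun _ : ℕ => (1 : ℝ)) T) * M + η * N
      simp only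
      linarith [mul_add (min η (1 / 2)) M (N : ℝ)]
    · -- lower
      have h1 : M - min η (1 / 2) * (M + N) ≤ S := by linarith [hab.1]
      have h2 : Real.exp (-(1 : ℝ)) * M ≤ 1 / 2 * M := mul_le_mul_of_nonneg_right he' hM
      show Real.exp (-(fun _ : ℕ => (1 : ℝ)) T) * M ≤ S + η * N
      simp only
      linarith [mul_add (min η (1 / 2)) M (N : ℝ)]

end Summit.Parity.GeneralizedHardyLittlewood.Cruxes.RelativeDimOne.TranslateAmplification
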